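import Literature.NumberTheory.LFunctions.TrilinearKloostermanFractionsDiagTerm
import HarnessLib

/-!
# Trilinear forms with Kloosterman fractions: the per-term bound on the diagonal (Bettin–Chandee §3)

Topic `NumberTheory/LFunctions`.  S. Bettin, V. Chandee, *Trilinear forms with Kloosterman
fractions*, Adv. Math. 328 (2018), §3: "by symmetry and the inequality `2|ab| ≤ a² + b²`" the
diagonal is bounded through `|β_{n₁}ν_{a₁}|²` times the `m`-sums, each bounded by (3.3) or
trivially.  This file packages the explicit per-term bound
`B(ℓ₁,n₁,a₁;ℓ₂,a₂) = 2M` if `a₁ℓ₁ = a₂ℓ₂`, else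
`τ(q)((2M+1)(c,q)/q + τ(q')√q'(1+log q'))(1 + 2π(|η||c|/q)/M)` (`q = bℓ₁n₁`, `c = a₁ℓ₁ − a₂ℓ₂`,
`q' = q/(c,q)`) of `TrilinearKloostermanFractionsDiagTerm.lean` for the symmetrization step:

* `BC_diagB_nonneg` — `B ≥ 0`;
* `BC_diagB_symm` — on the diagonal `ℓ₁n₁ = ℓ₂n₂`, `B` is symmetric under
  `(ℓ₁,n₁,a₁) ↔ (ℓ₂,n₂,a₂)`;
* **`BC_diag_term_le_B`** — `‖γ_{n₁}‖‖ν_{a₁}‖ ‖γ_{n₂}‖‖ν_{a₂}‖ ‖S‖ ≤ B · (‖γ_{n₁}‖‖ν_{a₁}‖)(‖γ_{n₂}‖‖ν_{a₂}‖)`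
  for the `m`-sum `S` of the expanded diagonal (`BC_diag_msum_le`, `BC_diag_msum_le'`, using the
  support conditions on `γ` to get `(ϑ, q) = 1`).

No new named facts (D-0026).

## References

* S. Bettin, V. Chandee, Adv. Math. 328 (2018) 1234–1262 (arXiv:1502.00769), §3 ((3.3) and the
  first display). [BettinChandee2018]
-/

noncomputable section

open Finset Real

namespace Literature.NumberTheory.LFunctions

/-- The per-term bound `B` is nonnegative (`M ≥ 0`). [folklore] -/
theorem BC_diagB_nonneg (b ℓ₁ n₁ a₁ ℓ₂ a₂ : ℕ) {M : ℝ} (η : ℝ) (hM : 0 ≤ M) :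
    0 ≤ (if (((a₁ * ℓ₁ : ℕ) : ℤ) - ((a₂ * ℓ₂ : ℕ) : ℤ)) = 0 then 2 * M else
            ((Nat.divisors (b * (ℓ₁ * n₁))).card : ℝ) *
              ((2 * M + 1) * (Int.gcd (((a₁ * ℓ₁ : ℕ) : ℤ) - ((a₂ * ℓ₂ : ℕ) : ℤ)) (((b * (ℓ₁ * n₁)) : ℕ) : ℤ) : ℝ) / (((b * (ℓ₁ * n₁)) : ℕ) : ℝ) +
                ((Nat.divisors ((b * (ℓ₁ * n₁)) / Int.gcd (((a₁ * ℓ₁ : ℕ) : ℤ) - ((a₂ * ℓ₂ : ℕ) : ℤ)) (((b * (ℓ₁ * n₁)) : ℕ) : ℤ))).card : ℝ) * Real.sqrt ((((b * (ℓ₁ * n₁)) / Int.gcd (((a₁ * ℓ₁ : ℕ) : ℤ) - ((a₂ * ℓ₂ : ℕ) : ℤ)) (((b * (ℓ₁ * n₁)) : ℕ) : ℤ)) : ℕ) : ℝ) *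
                  (1 + Real.log ((((b * (ℓ₁ * n₁)) / Int.gcd (((a₁ * ℓ₁ : ℕ) : ℤ) - ((a₂ * ℓ₂ : ℕ) : ℤ)) (((b * (ℓ₁ * n₁)) : ℕ) : ℤ)) : ℕ) : ℝ))) *
              (1 + 2 * Real.pi * (|η| * |((((a₁ * ℓ₁ : ℕ) : ℤ) - ((a₂ * ℓ₂ : ℕ) : ℤ)) : ℝ)| / (((b * (ℓ₁ * n₁)) : ℕ) : ℝ)) / M)) := by
  split_ifs
  · positivity
  · have hlog : 0 ≤ 1 + Real.log (((((b * (ℓ₁ * n₁)) / Int.gcd (((a₁ * ℓ₁ : ℕ) : ℤ) - ((a₂ * ℓ₂ : ℕ) : ℤ)) (((b * (ℓ₁ * n₁)) : ℕ) : ℤ))) : ℕ) : ℝ) := by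
      have := Real.log_natCast_nonneg (((b * (ℓ₁ * n₁)) / Int.gcd (((a₁ * ℓ₁ : ℕ) : ℤ) - ((a₂ * ℓ₂ : ℕ) : ℤ)) (((b * (ℓ₁ * n₁)) : ℕ) : ℤ)))
      linarith
    have h1 : 0 ≤ (2 * M + 1) * ((Int.gcd (((a₁ * ℓ₁ : ℕ) : ℤ) - ((a₂ * ℓ₂ : ℕ) : ℤ)) (((b * (ℓ₁ * n₁)) : ℕ) : ℤ)) : ℝ) / ((((b * (ℓ₁ * n₁))) : ℕ) : ℝ) := by
      positivity
    have h2 : 0 ≤ ((Nat.divisors ((b * (ℓ₁ * n₁)) / Int.gcd (((a₁ * ℓ₁ : ℕ) : ℤ) - ((a₂ * ℓ₂ : ℕ) : ℤ)) (((b * (ℓ₁ * n₁)) : ℕ) : ℤ))).card : ℝ) * Real.sqrt (((((b * (ℓ₁ * n₁)) / Int.gcd (((a₁ * ℓ₁ : ℕ) : ℤ) - ((a₂ * ℓ₂ : ℕ) : ℤ)) (((b * (ℓ₁ * n₁)) : ℕ) : ℤ))) : ℕ) : ℝ) *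
        (1 + Real.log (((((b * (ℓ₁ * n₁)) / Int.gcd (((a₁ * ℓ₁ : ℕ) : ℤ) - ((a₂ * ℓ₂ : ℕ) : ℤ)) (((b * (ℓ₁ * n₁)) : ℕ) : ℤ))) : ℕ) : ℝ)) := by positivity
    have h3 : 0 ≤ 1 + 2 * Real.pi * (|η| * |(((((a₁ * ℓ₁ : ℕ) : ℤ) - ((a₂ * ℓ₂ : ℕ) : ℤ))) : ℝ)| / ((((b * (ℓ₁ * n₁))) : ℕ) : ℝ)) / M := by
      positivity
    exact mul_nonneg (mul_nonneg (Nat.cast_nonneg _) (add_nonneg h1 h2)) h3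

/-- **Symmetry of `B` on the diagonal**: for `ℓ₁n₁ = ℓ₂n₂` the moduli agree and
`c ↦ -c`, which changes neither `(c,q)`, `|c|` nor the condition `c = 0`. [folklore] -/
theorem BC_diagB_symm (b ℓ₁ n₁ a₁ ℓ₂ n₂ a₂ : ℕ) (M : ℝ) (η : ℝ) (hN : ℓ₁ * n₁ = ℓ₂ * n₂) :
    (if (((a₁ * ℓ₁ : ℕ) : ℤ) - ((a₂ * ℓ₂ : ℕ) : ℤ)) = 0 then 2 * M else
            ((Nat.divisors (b * (ℓ₁ * n₁))).card : ℝ) *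
              ((2 * M + 1) * (Int.gcd (((a₁ * ℓ₁ : ℕ) : ℤ) - ((a₂ * ℓ₂ : ℕ) : ℤ)) (((b * (ℓ₁ * n₁)) : ℕ) : ℤ) : ℝ) / (((b * (ℓ₁ * n₁)) : ℕ) : ℝ) +
                ((Nat.divisors ((b * (ℓ₁ * n₁)) / Int.gcd (((a₁ * ℓ₁ : ℕ) : ℤ) - ((a₂ * ℓ₂ : ℕ) : ℤ)) (((b * (ℓ₁ * n₁)) : ℕ) : ℤ))).card : ℝ) * Real.sqrt ((((b * (ℓ₁ * n₁)) / Int.gcd (((a₁ * ℓ₁ : ℕ) : ℤ) - ((a₂ * ℓ₂ : ℕ) : ℤ)) (((b * (ℓ₁ * n₁)) : ℕ) : ℤ)) : ℕ) : ℝ) *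
                  (1 + Real.log ((((b * (ℓ₁ * n₁)) / Int.gcd (((a₁ * ℓ₁ : ℕ) : ℤ) - ((a₂ * ℓ₂ : ℕ) : ℤ)) (((b * (ℓ₁ * n₁)) : ℕ) : ℤ)) : ℕ) : ℝ))) *
              (1 + 2 * Real.pi * (|η| * |((((a₁ * ℓ₁ : ℕ) : ℤ) - ((a₂ * ℓ₂ : ℕ) : ℤ)) : ℝ)| / (((b * (ℓ₁ * n₁)) : ℕ) : ℝ)) / M)) =
    (if (((a₂ * ℓ₂ : ℕ) : ℤ) - ((a₁ * ℓ₁ : ℕ) : ℤ)) = 0 then 2 * M else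
            ((Nat.divisors (b * (ℓ₂ * n₂))).card : ℝ) *
              ((2 * M + 1) * (Int.gcd (((a₂ * ℓ₂ : ℕ) : ℤ) - ((a₁ * ℓ₁ : ℕ) : ℤ)) (((b * (ℓ₂ * n₂)) : ℕ) : ℤ) : ℝ) / (((b * (ℓ₂ * n₂)) : ℕ) : ℝ) +
                ((Nat.divisors ((b * (ℓ₂ * n₂)) / Int.gcd (((a₂ * ℓ₂ : ℕ) : ℤ) - ((a₁ * ℓ₁ : ℕ) : ℤ)) (((b * (ℓ₂ * n₂)) : ℕ) : ℤ))).card : ℝ) * Real.sqrt ((((b * (ℓ₂ * n₂)) / Int.gcd (((a₂ * ℓ₂ : ℕ) : ℤ) - ((a₁ * ℓ₁ : ℕ) : ℤ)) (((b * (ℓ₂ * n₂)) : ℕ) : ℤ)) : ℕ) : ℝ) *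
                  (1 + Real.log ((((b * (ℓ₂ * n₂)) / Int.gcd (((a₂ * ℓ₂ : ℕ) : ℤ) - ((a₁ * ℓ₁ : ℕ) : ℤ)) (((b * (ℓ₂ * n₂)) : ℕ) : ℤ)) : ℕ) : ℝ))) *
              (1 + 2 * Real.pi * (|η| * |((((a₂ * ℓ₂ : ℕ) : ℤ) - ((a₁ * ℓ₁ : ℕ) : ℤ)) : ℝ)| / (((b * (ℓ₂ * n₂)) : ℕ) : ℝ)) / M)) := by
  have hq : (b * (ℓ₂ * n₂)) = (b * (ℓ₁ * n₁)) := by rw [hN]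
  have hc : (((a₂ * ℓ₂ : ℕ) : ℤ) - ((a₁ * ℓ₁ : ℕ) : ℤ)) = -(((a₁ * ℓ₁ : ℕ) : ℤ) - ((a₂ * ℓ₂ : ℕ) : ℤ)) := by ring
  have hgcd : Int.gcd (-(((a₁ * ℓ₁ : ℕ) : ℤ) - ((a₂ * ℓ₂ : ℕ) : ℤ))) ((((b * (ℓ₁ * n₁))) : ℕ) : ℤ) = Int.gcd (((a₁ * ℓ₁ : ℕ) : ℤ) - ((a₂ * ℓ₂ : ℕ) : ℤ)) ((((b * (ℓ₁ * n₁))) : ℕ) : ℤ) := by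
    rw [Int.gcd_eq_natAbs, Int.natAbs_neg, ← Int.gcd_eq_natAbs]
  have hcR : ((((a₂ * ℓ₂ : ℕ) : ℤ) : ℝ) - (((a₁ * ℓ₁ : ℕ) : ℤ) : ℝ)) =
      -((((a₁ * ℓ₁ : ℕ) : ℤ) : ℝ) - (((a₂ * ℓ₂ : ℕ) : ℤ) : ℝ)) := by ring
  rw [hq, hc, hgcd, hcR, abs_neg]
  simp only [neg_eq_zero]

/-- **The per-term bound** (Bettin–Chandee §3: the `m`-sum is bounded by (3.3) when
`a₁ℓ₁ ≠ a₂ℓ₂` and trivially otherwise): for `ℓ₁ ∈ 𝓛`, `n₁, n₂ ≥ 1`, `ℓ₁n₁ = ℓ₂n₂`, `M ≥ 1/2`,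
`(b, ϑ) = 1` and `γ` supported on squarefree integers coprime to `bϑ`,
`‖γ_{n₁}‖‖ν_{a₁}‖ ‖γ_{n₂}‖‖ν_{a₂}‖ ‖S‖ ≤ B · ((‖γ_{n₁}‖‖ν_{a₁}‖)(‖γ_{n₂}‖‖ν_{a₂}‖))`.
[cite: BettinChandee2018, §3 (3.3)] -/
theorem BC_diag_term_le_B {b ℓ₁ n₁ a₁ ℓ₂ n₂ a₂ L : ℕ} {M : ℝ} (ϑ : ℤ) (η : ℝ) (γ ν : ℕ → ℂ)
    (hb : 0 < b) (hM : 1 / 2 ≤ M) (hbϑ : b.Coprime ϑ.natAbs)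
    (hℓ₁ : ℓ₁ ∈ ((Ioc L (2 * L)).filter (fun ℓ => ℓ.Prime ∧ ℓ.Coprime b ∧ ℓ.Coprime ϑ.natAbs))) (hn₁ : 0 < n₁) (hn₂ : 0 < n₂) (hN : ℓ₁ * n₁ = ℓ₂ * n₂)
    (hγcop : ∀ n : ℕ, γ n ≠ 0 → Squarefree n ∧ n.Coprime b ∧ n.Coprime ϑ.natAbs) :
    (‖γ n₁‖ * ‖ν a₁‖) * (‖γ n₂‖ * ‖ν a₂‖) *
        ‖∑ m ∈ (Ioc ⌊M⌋₊ ⌊2 * M⌋₊).filter (fun m => m.Coprime b),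
            (if (ℓ₂ * n₂).Coprime m then
              Complex.exp (2 * Real.pi * Complex.I *
                ((ϑ : ℂ) * (a₁ : ℂ) * ((((m : ZMod (b * n₁))⁻¹).val : ℕ) : ℂ) / ((b * n₁ : ℕ) : ℂ) +
                  (η : ℂ) * (a₁ : ℂ) / ((m : ℂ) * ((b * n₁ : ℕ) : ℂ)))) *
              (starRingEnd ℂ) (Complex.exp (2 * Real.pi * Complex.I *
                ((ϑ : ℂ) * (a₂ : ℂ) * ((((m : ZMod (b * n₂))⁻¹).val : ℕ) : ℂ) / ((b * n₂ : ℕ) : ℂ) +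
                  (η : ℂ) * (a₂ : ℂ) / ((m : ℂ) * ((b * n₂ : ℕ) : ℂ))))) else 0)‖ ≤
      (if (((a₁ * ℓ₁ : ℕ) : ℤ) - ((a₂ * ℓ₂ : ℕ) : ℤ)) = 0 then 2 * M else
            ((Nat.divisors (b * (ℓ₁ * n₁))).card : ℝ) *
              ((2 * M + 1) * (Int.gcd (((a₁ * ℓ₁ : ℕ) : ℤ) - ((a₂ * ℓ₂ : ℕ) : ℤ)) (((b * (ℓ₁ * n₁)) : ℕ) : ℤ) : ℝ) / (((b * (ℓ₁ * n₁)) : ℕ) : ℝ) +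
                ((Nat.divisors ((b * (ℓ₁ * n₁)) / Int.gcd (((a₁ * ℓ₁ : ℕ) : ℤ) - ((a₂ * ℓ₂ : ℕ) : ℤ)) (((b * (ℓ₁ * n₁)) : ℕ) : ℤ))).card : ℝ) * Real.sqrt ((((b * (ℓ₁ * n₁)) / Int.gcd (((a₁ * ℓ₁ : ℕ) : ℤ) - ((a₂ * ℓ₂ : ℕ) : ℤ)) (((b * (ℓ₁ * n₁)) : ℕ) : ℤ)) : ℕ) : ℝ) *
                  (1 + Real.log ((((b * (ℓ₁ * n₁)) / Int.gcd (((a₁ * ℓ₁ : ℕ) : ℤ) - ((a₂ * ℓ₂ : ℕ) : ℤ)) (((b * (ℓ₁ * n₁)) : ℕ) : ℤ)) : ℕ) : ℝ))) *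
              (1 + 2 * Real.pi * (|η| * |((((a₁ * ℓ₁ : ℕ) : ℤ) - ((a₂ * ℓ₂ : ℕ) : ℤ)) : ℝ)| / (((b * (ℓ₁ * n₁)) : ℕ) : ℝ)) / M)) *
        ((‖γ n₁‖ * ‖ν a₁‖) * (‖γ n₂‖ * ‖ν a₂‖)) := by
  have hB0 := BC_diagB_nonneg b ℓ₁ n₁ a₁ ℓ₂ a₂ η (M := M) (by linarith)
  have hxx : 0 ≤ (‖γ n₁‖ * ‖ν a₁‖) * (‖γ n₂‖ * ‖ν a₂‖) := by positivity
  by_cases hγ : γ n₁ = 0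
  · rw [hγ, norm_zero, zero_mul, zero_mul, zero_mul, mul_zero]
  obtain ⟨-, -, hn₁ϑ⟩ := hγcop n₁ hγ
  obtain ⟨-, hℓ₁p, -, hℓ₁ϑ⟩ := Finset.mem_filter.mp hℓ₁
  -- `(ϑ, q) = 1`
  have hϑq : (ϑ.natAbs).Coprime (b * (ℓ₁ * n₁)) :=
    Nat.Coprime.mul_right hbϑ.symm (Nat.Coprime.mul_right hℓ₁ϑ.symm hn₁ϑ.symm)
  -- `‖S‖ ≤ B`
  have hS : ‖∑ m ∈ (Ioc ⌊M⌋₊ ⌊2 * M⌋₊).filter (fun m => m.Coprime b),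
            (if (ℓ₂ * n₂).Coprime m then
              Complex.exp (2 * Real.pi * Complex.I *
                ((ϑ : ℂ) * (a₁ : ℂ) * ((((m : ZMod (b * n₁))⁻¹).val : ℕ) : ℂ) / ((b * n₁ : ℕ) : ℂ) +
                  (η : ℂ) * (a₁ : ℂ) / ((m : ℂ) * ((b * n₁ : ℕ) : ℂ)))) *
              (starRingEnd ℂ) (Complex.exp (2 * Real.pi * Complex.I *
                ((ϑ : ℂ) * (a₂ : ℂ) * ((((m : ZMod (b * n₂))⁻¹).val : ℕ) : ℂ) / ((b * n₂ : ℕ) : ℂ) +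
                  (η : ℂ) * (a₂ : ℂ) / ((m : ℂ) * ((b * n₂ : ℕ) : ℂ))))) else 0)‖ ≤
      (if (((a₁ * ℓ₁ : ℕ) : ℤ) - ((a₂ * ℓ₂ : ℕ) : ℤ)) = 0 then 2 * M else
            ((Nat.divisors (b * (ℓ₁ * n₁))).card : ℝ) *
              ((2 * M + 1) * (Int.gcd (((a₁ * ℓ₁ : ℕ) : ℤ) - ((a₂ * ℓ₂ : ℕ) : ℤ)) (((b * (ℓ₁ * n₁)) : ℕ) : ℤ) : ℝ) / (((b * (ℓ₁ * n₁)) : ℕ) : ℝ) +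
                ((Nat.divisors ((b * (ℓ₁ * n₁)) / Int.gcd (((a₁ * ℓ₁ : ℕ) : ℤ) - ((a₂ * ℓ₂ : ℕ) : ℤ)) (((b * (ℓ₁ * n₁)) : ℕ) : ℤ))).card : ℝ) * Real.sqrt ((((b * (ℓ₁ * n₁)) / Int.gcd (((a₁ * ℓ₁ : ℕ) : ℤ) - ((a₂ * ℓ₂ : ℕ) : ℤ)) (((b * (ℓ₁ * n₁)) : ℕ) : ℤ)) : ℕ) : ℝ) *
                  (1 + Real.log ((((b * (ℓ₁ * n₁)) / Int.gcd (((a₁ * ℓ₁ : ℕ) : ℤ) - ((a₂ * ℓ₂ : ℕ) : ℤ)) (((b * (ℓ₁ * n₁)) : ℕ) : ℤ)) : ℕ) : ℝ))) *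
              (1 + 2 * Real.pi * (|η| * |((((a₁ * ℓ₁ : ℕ) : ℤ) - ((a₂ * ℓ₂ : ℕ) : ℤ)) : ℝ)| / (((b * (ℓ₁ * n₁)) : ℕ) : ℝ)) / M)) := by
    by_cases hc : (((a₁ * ℓ₁ : ℕ) : ℤ) - ((a₂ * ℓ₂ : ℕ) : ℤ)) = 0
    · rw [if_pos hc]
      exact (BC_diag_msum_le ϑ η a₁ a₂ hb hℓ₁p.pos hn₁ hn₂ hN hM).1 hc
    · rw [if_neg hc]
      have h := BC_diag_msum_le' ϑ η a₁ a₂ hb hℓ₁p.pos hn₁ hn₂ hN hM hc hϑq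
      rwa [Int.cast_sub] at h
  calc (‖γ n₁‖ * ‖ν a₁‖) * (‖γ n₂‖ * ‖ν a₂‖) *
        ‖∑ m ∈ (Ioc ⌊M⌋₊ ⌊2 * M⌋₊).filter (fun m => m.Coprime b),
            (if (ℓ₂ * n₂).Coprime m then
              Complex.exp (2 * Real.pi * Complex.I *
                ((ϑ : ℂ) * (a₁ : ℂ) * ((((m : ZMod (b * n₁))⁻¹).val : ℕ) : ℂ) / ((b * n₁ : ℕ) : ℂ) +
                  (η : ℂ) * (a₁ : ℂ) / ((m : ℂ) * ((b * n₁ : ℕ) : ℂ)))) *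
              (starRingEnd ℂ) (Complex.exp (2 * Real.pi * Complex.I *
                ((ϑ : ℂ) * (a₂ : ℂ) * ((((m : ZMod (b * n₂))⁻¹).val : ℕ) : ℂ) / ((b * n₂ : ℕ) : ℂ) +
                  (η : ℂ) * (a₂ : ℂ) / ((m : ℂ) * ((b * n₂ : ℕ) : ℂ))))) else 0)‖
      ≤ (‖γ n₁‖ * ‖ν a₁‖) * (‖γ n₂‖ * ‖ν a₂‖) *
        (if (((a₁ * ℓ₁ : ℕ) : ℤ) - ((a₂ * ℓ₂ : ℕ) : ℤ)) = 0 then 2 * M else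
            ((Nat.divisors (b * (ℓ₁ * n₁))).card : ℝ) *
              ((2 * M + 1) * (Int.gcd (((a₁ * ℓ₁ : ℕ) : ℤ) - ((a₂ * ℓ₂ : ℕ) : ℤ)) (((b * (ℓ₁ * n₁)) : ℕ) : ℤ) : ℝ) / (((b * (ℓ₁ * n₁)) : ℕ) : ℝ) +
                ((Nat.divisors ((b * (ℓ₁ * n₁)) / Int.gcd (((a₁ * ℓ₁ : ℕ) : ℤ) - ((a₂ * ℓ₂ : ℕ) : ℤ)) (((b * (ℓ₁ * n₁)) : ℕ) : ℤ))).card : ℝ) * Real.sqrt ((((b * (ℓ₁ * n₁)) / Int.gcd (((a₁ * ℓ₁ : ℕ) : ℤ) - ((a₂ * ℓ₂ : ℕ) : ℤ)) (((b * (ℓ₁ * n₁)) : ℕ) : ℤ)) : ℕ) : ℝ) *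
                  (1 + Real.log ((((b * (ℓ₁ * n₁)) / Int.gcd (((a₁ * ℓ₁ : ℕ) : ℤ) - ((a₂ * ℓ₂ : ℕ) : ℤ)) (((b * (ℓ₁ * n₁)) : ℕ) : ℤ)) : ℕ) : ℝ))) *
              (1 + 2 * Real.pi * (|η| * |((((a₁ * ℓ₁ : ℕ) : ℤ) - ((a₂ * ℓ₂ : ℕ) : ℤ)) : ℝ)| / (((b * (ℓ₁ * n₁)) : ℕ) : ℝ)) / M)) := mul_le_mul_of_nonneg_left hS hxx
    _ = _ := by ring

end Literature.NumberTheory.LFunctions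

end
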